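import Summits.NavierStokesRegularity.NavierStokesRegularity.Theses.PalasekTowerBreakdown
import Summits.NavierStokesRegularity.FluidComputer.PalasekTowerRegisterGlobalCeiling

/-!
# NavierStokesRegularity — route `PalasekTowerBreakdown`: the child crux `HeredityFromTwo` re-typed —
# its upper stub is the a-priori ceiling (existence up to the next readout is a theorem)

Supports `stmt-NavierStokesRegularity-19250` (`PalasekTowerBreakdown.HeredityFromTwo :=
HeredityFrom 2`; registered skeleton `Cruxes/HeredityFromTwo/Lines/birth.lean`, stubs
`stub_continuation_envelope : ContinuationEnvelope` / `stub_readout_floors : ReadoutFloors`). Cell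
`ns-blowup`, seat `ns-blowup-ecbridge-5` (g2). LABEL: E–C typing (pure glue over landed register
theorems). WHAT THIS IS NOT: not NS — no stage, tower or instance is constructed; the child crux is
OPEN and is not claimed here; every theorem below has it (or its halves) as hypothesis or states an
equivalence.

The UPPER stub `ContinuationEnvelope` asks that every registered stage at a generic level `k ≥ 2`
CONTINUE classically with finite energy to `τ (k+1)` inside the next ceiling `c₂ Y_{k+1}`.
`FluidComputer/PalasekTowerRegisterGlobalApriori.lean` proves that the existence half of this is a
THEOREM given the bound in a-priori form (Leray–Hopf from finite energy, Tao 2013 Lemma 8.1; global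
Leray–Hopf extension, Leray 1934; continuation of bounded classical representatives to a prescribed
time, Robinson–Rodrigo–Sadowski 2016 Thm. 8.17 iterated,
`Literature/…/LerayHopfClassicalContinuationApriori.lean`; gluing and pressure re-gauge), and
`FluidComputer/PalasekTowerRegisterGlobalCeiling.lean` names the a-priori form `AprioriCeiling`
(«every finite-energy classical continuation of a registered stage at `k ≥ 2` on any
`[0, T'] ⊆ [0, τ (k+1)]` stays `≤ c₂ Y_{k+1}`» — a pure `∀`-bound, no existence clause). Against
the ROUTE DECL, by name:

* `palasekTowerBreakdown_heredityFromTwo_iff_apriori_floors :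
  PalasekTowerBreakdown.HeredityFromTwo ↔ AprioriCeiling ∧ ReadoutFloors` (no hypothesis): the
  child crux is EXACTLY two `∀`-bounds on the (unique) continuation of a registered stage — no
  overshoot before `τ (k+1)`, and the three level-`k+1` floors at `τ (k+1)`; premature blow-up /
  loss of finite energy is excluded by theorem, not assumed;
* `palasekTowerBreakdown_heredityFromTwo_of_apriori_floors` (the composition concluding the child BY
  NAME from the re-typed upper stub and the lower stub), the projection
  `palasekTowerBreakdown_heredityFromTwo_aprioriCeiling`, `palasekTowerBreakdown_continuationEnvelope_iff`
  (`ContinuationEnvelope ↔ AprioriCeiling`), and the parent's re-typed three-way split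
  `palasekTowerBreakdown_episodeInduction_iff_apriori :
  EpisodeInduction ↔ HeredityAtOne ∧ AprioriCeiling ∧ ReadoutFloors`.

References: S. Palasek, arXiv:2605.13827 §4 [cite: Palasek2026ElementaryModel, §4]; J. C. Robinson,
J. L. Rodrigo, W. Sadowski, CUP 2016, Thm. 8.17 [cite: RobinsonRodrigoSadowski2016, Thm. 8.17];
T. Tao, Anal. PDE 6 (2013), Lemma 8.1, Cor. 11.4 [cite: Tao2011, Cor. 11.4].
-/

-- `Summit.<Summit>.<Problem>` is the tree's mandated summit-side namespace (CONVENTIONS §2); for this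
-- single-conjunct summit the two coincide, so the duplicate is deliberate.
set_option linter.dupNamespace false

namespace Summit.NavierStokesRegularity.NavierStokesRegularity.Theorems

open Summit.NavierStokesRegularity.NavierStokesRegularity.Theses
open Summit.NavierStokesRegularity.FluidComputer.PalasekTowerClayBridge

/-- **The child crux re-typed (no hypothesis)**: `PalasekTowerBreakdown.HeredityFromTwo` is
EQUIVALENT to the a-priori ceiling together with the readout floors (register theorem
`heredityFrom_two_iff_aprioriCeiling_and_floors`). [folklore] -/
theorem palasekTowerBreakdown_heredityFromTwo_iff_apriori_floors :
    PalasekTowerBreakdown.HeredityFromTwo ↔ AprioriCeiling ∧ ReadoutFloors :=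
  heredityFrom_two_iff_aprioriCeiling_and_floors

/-- **The composition concluding the child crux BY NAME** from the re-typed upper stub and the lower
stub: `AprioriCeiling → ReadoutFloors → PalasekTowerBreakdown.HeredityFromTwo`. [folklore] -/
theorem palasekTowerBreakdown_heredityFromTwo_of_apriori_floors (hA : AprioriCeiling)
    (hB : ReadoutFloors) : PalasekTowerBreakdown.HeredityFromTwo :=
  heredityFrom_two_of_aprioriCeiling_floors hA hB

/-- The child crux yields the a-priori ceiling (so `AprioriCeiling` is a consequence OF the child: a
refutation of it refutes the child and the parent). [folklore] -/
theorem palasekTowerBreakdown_heredityFromTwo_aprioriCeiling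
    (h : PalasekTowerBreakdown.HeredityFromTwo) : AprioriCeiling :=
  AprioriCeiling.of_heredityFrom_two h

/-- **The registered upper stub IS the a-priori ceiling**: `ContinuationEnvelope ↔ AprioriCeiling`
(⇐: the a-priori continuation theorem `Stage.exists_continuation_of_apriori`; ⇒: silent-window
uniqueness). [cite: RobinsonRodrigoSadowski2016, Thm. 8.17] -/
theorem palasekTowerBreakdown_continuationEnvelope_iff : ContinuationEnvelope ↔ AprioriCeiling :=
  continuationEnvelope_iff_aprioriCeiling

/-- **The parent's three-way split, re-typed (no hypothesis)**: the route decl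
`PalasekTowerBreakdown.EpisodeInduction` (= K2G `EpisodeInductionG`) is EQUIVALENT to the first rung
`PalasekTowerBreakdown.HeredityAtOne` together with the a-priori ceiling and the readout floors at
the generic levels. [folklore] -/
theorem palasekTowerBreakdown_episodeInduction_iff_apriori :
    PalasekTowerBreakdown.EpisodeInduction ↔
      PalasekTowerBreakdown.HeredityAtOne ∧ AprioriCeiling ∧ ReadoutFloors :=
  episodeInductionG_iff_rung_aprioriCeiling_floors

/-- **A-priori continuation of a registered stage, in the route's setting** (register theorem
`Stage.exists_continuation_of_apriori` at unit viscosity on the wide rates): for a quiet schedule,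
a registered stage `s` at level `k ≥ 2` and any `T₁ ≥ τ k`, if every finite-energy classical
continuation of `s` on any `[0, T'] ⊆ [0, T₁]` is bounded by `M` on `[τ k, T']`, then `s` HAS a
finite-energy classical continuation on `[0, T₁]` agreeing with it in velocity and pressure on
`[0, τ k]`. [cite: RobinsonRodrigoSadowski2016, Thm. 8.17] -/
theorem palasekTowerBreakdown_stage_exists_continuation_of_apriori {S : Schedule TowerRates.wide}
    (hQ : S.Quiet) {k : ℕ} (hk : 2 ≤ k)
    (s : Stage 1 TowerRates.wide S (Margins.routeG TowerRates.wide) k) {T₁ : ℝ} (hT₁ : S.τ k ≤ T₁)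
    {M : ℝ}
    (hM : ∀ T' ∈ Set.Icc (S.τ k) T₁,
      ∀ (u : ℝ → EuclideanSpace ℝ (Fin 3) → EuclideanSpace ℝ (Fin 3))
        (p : ℝ → EuclideanSpace ℝ (Fin 3) → ℝ),
      Literature.Analysis.FluidPDE.IsClassicalNSSolutionOn (Set.Icc 0 T') 1 S.f u p →
      (∀ t ∈ Set.Icc 0 (S.τ k), u t = s.u t ∧ p t = s.p t) →
      (∃ C : ENNReal, C < ⊤ ∧ ∀ t ∈ Set.Icc 0 T', ∫⁻ x, ‖u t x‖ₑ ^ 2 ≤ C) →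
      ∀ t ∈ Set.Icc (S.τ k) T', ∀ x, ‖u t x‖ ≤ M) :
    ∃ (u : ℝ → EuclideanSpace ℝ (Fin 3) → EuclideanSpace ℝ (Fin 3))
      (p : ℝ → EuclideanSpace ℝ (Fin 3) → ℝ),
      Literature.Analysis.FluidPDE.IsClassicalNSSolutionOn (Set.Icc 0 T₁) 1 S.f u p ∧
      (∀ t ∈ Set.Icc 0 (S.τ k), u t = s.u t ∧ p t = s.p t) ∧
      (∃ C : ENNReal, C < ⊤ ∧ ∀ t ∈ Set.Icc 0 T₁, ∫⁻ x, ‖u t x‖ₑ ^ 2 ≤ C) :=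
  s.exists_continuation_of_apriori one_pos hQ hk hT₁ hM

end Summit.NavierStokesRegularity.NavierStokesRegularity.Theorems
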